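import Literature.Geometry.Riemannian.AlmostNonnegRicciFibrationCoverReduction
import HarnessLib

/-!
# Huang–Huang–Wang–Zhu 2026, Main Theorem 1 at `n = 4`, `b₁ = 1`: the contradiction-sequence form
of the remaining analytic core

Fourth reduction file for the named fact
`Literature.Geometry.Riemannian.huangHuangWangZhu2026_fibresOverCircle_four`
(`AlmostNonnegRicciFibration.lean`). The third file (`AlmostNonnegRicciFibrationCoverReduction.lean`)
reduced the fact to its equivariant analytic core (E) on the connected infinite cyclic cover
(`huangHuangWangZhu2026_fibresOverCircle_four_of_generator_equivariant`): for every `κ > 0` there is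
`δ > 0` such that for every datum — a closed smooth `P ≃ₕ S¹ × S³`, a smooth metric `g` with
`diam ≤ 1`, `sec ≥ -κ`, `Ric ≥ -δ g`, and a smooth `f₀ : P → S¹` with connected cyclic cover `P̂` —
there is a smooth `F : P̂ → ℝ`, equivariant under the generator of the deck group
(`F(1 +ᵥ x̂) = F x̂ + c`), without critical points.

The printed proof of Main Theorem 1 (H. Huang, X.-T. Huang, J. Wang, X. Zhu, arXiv:2605.24380, §4,
p. 13) is by contradiction along a sequence: "Suppose on the contrary, there exists a sequence of
`n`-dimensional manifolds `Mᵢ` satisfying `Ric_{Mᵢ} ≥ -εᵢ`, `sec_{Mᵢ} ≥ -1`, `diam(Mᵢ) ≤ 1`,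
`b₁(Mᵢ) = b`, where `εᵢ ↓ 0`, but each `Mᵢ` is not a fiber bundle over a `b`-torus", after which
everything happens to the sequence of covers `(M̂ᵢ, p̂ᵢ, Hᵢ)` and its pointed equivariant
Gromov–Hausdorff limit (diagram (4.1)). This file performs exactly that logical step for (E), so
that the remaining target is literally sequential and its objects are a SEQUENCE of the tree's
covers `CyclicCover (D i).f₀` (proper geodesic metric spaces with isometric, free, properly
discontinuous, cocompact deck action containing lines — `CyclicCoverOrbitSpace.lean`,
`CyclicCoverLine.lean` — ready for `PointedGHConv` of `MetricGeometry/PointedGromovHausdorff.lean`):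

* `CoreDatum κ δ` — the bundled data of one manifold of the sequence (the hypotheses of the fact
  verbatim, plus the auxiliary smooth circle map with connected cyclic cover), with its instances
  registered; `CoreDatum.Good D` — the conclusion of (E) for `D`;
* `CoreDatum.ofLE` — a datum for `δ` is a datum for every `δ' ≥ δ` (`Ric ≥ -δ g ≥ -δ' g`);
* `huangHuangWangZhu2026_fibresOverCircle_four_of_coreDatum` — (E) in bundled form implies the
  fact;
* `huangHuangWangZhu2026_fibresOverCircle_four_of_seq` — **the contradiction-sequence form**: if
  for every `κ > 0` and every sequence of data `Dᵢ : CoreDatum κ δᵢ` with `δᵢ > 0`, `δᵢ → 0`, SOME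
  `Dᵢ` is good, then the fact holds (choice of a bad datum for each `δ = 1/(i+1)`).

Everything here is a definition with body or a proved theorem; the analytic content (E) stays a
hypothesis; no named facts.

## References

* H. Huang, X.-T. Huang, J. Wang, X. Zhu, arXiv:2605.24380 (2026), Main Theorem 1 (p. 3), §4
  p. 13 (the contradiction sequence and diagram (4.1)). [HuangHuangWangZhu2026]
-/

noncomputable section

open scoped Manifold ContDiff Topology Real
open Function Set Filter

namespace Literature.Geometry.Riemannian

open Literature.Topology.FourManifolds Literature.Topology.FourManifolds.CircleMaps
  Literature.Topology.FourManifolds.CircleMaps.CyclicCover Literature.Geometry.Manifold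

/-- Local notation: the unit circle in `EuclideanSpace ℝ (Fin 2)` (the tree's `𝕊 1`). -/
local notation "𝕊¹" => (Metric.sphere (0 : EuclideanSpace ℝ (Fin 2)) 1)
/-- Local notation: the unit `3`-sphere in `EuclideanSpace ℝ (Fin 4)` (the tree's `𝕊 3`). -/
local notation "𝕊³" => (Metric.sphere (0 : EuclideanSpace ℝ (Fin 4)) 1)

/-! ### The data of one manifold of the contradiction sequence -/

/-- **One term of the contradiction sequence of Huang–Huang–Wang–Zhu 2026, §4** (p. 13: "a sequence
of `n`-dimensional manifolds `Mᵢ` satisfies `Ric ≥ -εᵢ`, `sec ≥ -1`, `diam(Mᵢ) ≤ 1`, `b₁(Mᵢ) = b`"),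
for `n = 4`, `b₁ = 1`, in the normalisation of the vendored fact: a closed smooth `4`-manifold `P`
homotopy equivalent to `S¹ × S³`, a smooth Riemannian metric `g` with `diam ≤ 1`, `sec ≥ -κ` (Gram
form) and `Ric ≥ -δ g` — the hypotheses of
`huangHuangWangZhu2026_fibresOverCircle_four` verbatim — together with the auxiliary smooth circle
map `f₀` with connected infinite cyclic cover `P̂ = CyclicCover f₀` (which always exists,
`exists_contMDiff_pathConnectedSpace_cyclicCover`; it is part of the data so that the covers `M̂ᵢ`
of diagram (4.1) are definite objects). [cite: HuangHuangWangZhu2026, §4 p. 13] -/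
structure CoreDatum (κ δ : ℝ) : Type 1 where
  /-- the manifold -/
  P : Type
  [top : TopologicalSpace P]
  [t2 : T2Space P]
  [secondCountable : SecondCountableTopology P]
  [charted : ChartedSpace (EuclideanSpace ℝ (Fin 4)) P]
  [manifold : IsManifold (𝓡 4) ∞ P]
  [compact : CompactSpace P]
  /-- the homotopy equivalence with `S¹ × S³` -/
  e : ContinuousMap.HomotopyEquiv P (𝕊¹ × 𝕊³)
  /-- the smooth Riemannian metric -/
  g : Bundle.ContMDiffRiemannianMetric (𝓡 4) ∞ (EuclideanSpace ℝ (Fin 4)) (TangentSpace (𝓡 4) : P → Type _)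
  [leviCivita : (Literature.Geometry.Lorentzian.PseudoRiemannianMetric.ofRiemannian g).HasLeviCivita]
  /-- `diam(P, g) ≤ 1` -/
  hdiam : (open Bundle in letI : Bundle.RiemannianBundle (fun x : P ↦ TangentSpace (𝓡 4) x) :=
    ⟨g.toContinuousRiemannianMetric.toRiemannianMetric⟩; ∀ x y : P, Manifold.riemannianEDist (𝓡 4) x y ≤ 1)
  /-- `sec ≥ -κ` in Gram form -/
  hsec : ∀ (x : P) (X Y : TangentSpace (𝓡 4) x),
    -κ * (g.inner x X X * g.inner x Y Y - g.inner x X Y ^ 2) ≤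
      (Literature.Geometry.Lorentzian.PseudoRiemannianMetric.ofRiemannian g).curvatureForm
        (Literature.Geometry.Lorentzian.PseudoRiemannianMetric.ofRiemannian g).leviCivita x X Y Y X
  /-- `Ric ≥ -δ g` -/
  hric : ∀ (x : P) (w : TangentSpace (𝓡 4) x),
    -δ * g.inner x w w ≤ (Literature.Geometry.Lorentzian.PseudoRiemannianMetric.ofRiemannian g).ricci x w w
  /-- the auxiliary smooth circle map -/
  f₀ : C(P, Circle)
  /-- the circle map is smooth -/
  hf₀ : ContMDiff (𝓡 4) (𝓡 1) ∞ f₀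
  /-- its infinite cyclic cover is connected -/
  hconn : ConnectedSpace (CyclicCover f₀)

attribute [instance] CoreDatum.top CoreDatum.t2 CoreDatum.secondCountable CoreDatum.charted
  CoreDatum.manifold CoreDatum.compact CoreDatum.leviCivita CoreDatum.hconn

namespace CoreDatum

variable {κ δ δ' : ℝ}

/-- **The conclusion of the analytic core (E) for one datum** ("`dFᵢ` is non-degenerate at each
point", Huang–Huang–Wang–Zhu 2026, §4 p. 14, lifted to the cyclic cover): a smooth function on the
cover `P̂`, equivariant under the generator of the deck group, without critical points.
[cite: HuangHuangWangZhu2026, Theorem 1.11 and §4 p. 14] -/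
def Good (D : CoreDatum κ δ) : Prop :=
  ∃ F : CyclicCover D.f₀ → ℝ, ContMDiff (𝓡 4) 𝓘(ℝ, ℝ) ∞ F ∧
    (∃ c : ℝ, ∀ x : CyclicCover D.f₀, F ((1 : ℤ) +ᵥ x) = F x + c) ∧
    ∀ x : CyclicCover D.f₀, mfderiv (𝓡 4) 𝓘(ℝ, ℝ) F x ≠ 0

/-- Unfolding lemma for `Good`. [cite: HuangHuangWangZhu2026, §4 p. 14] -/
theorem good_iff (D : CoreDatum κ δ) : D.Good ↔
    ∃ F : CyclicCover D.f₀ → ℝ, ContMDiff (𝓡 4) 𝓘(ℝ, ℝ) ∞ F ∧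
      (∃ c : ℝ, ∀ x : CyclicCover D.f₀, F ((1 : ℤ) +ᵥ x) = F x + c) ∧
      ∀ x : CyclicCover D.f₀, mfderiv (𝓡 4) 𝓘(ℝ, ℝ) F x ≠ 0 :=
  Iff.rfl

/-- `g(w, w) ≥ 0` for a Riemannian metric. [folklore] -/
theorem inner_self_nonneg (D : CoreDatum κ δ) (x : D.P) (w : TangentSpace (𝓡 4) x) :
    0 ≤ D.g.inner x w w := by
  by_cases hw : w = 0
  · subst hw
    simp
  · exact (D.g.pos x w hw).le

/-- **Monotonicity in `δ`**: a datum with `Ric ≥ -δ g` is a datum with `Ric ≥ -δ' g` for every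
`δ' ≥ δ` (so along a sequence one may replace `δᵢ` by any larger null sequence).
[cite: HuangHuangWangZhu2026, §4 p. 13] -/
def ofLE (D : CoreDatum κ δ) (h : δ ≤ δ') : CoreDatum κ δ' where
  P := D.P
  e := D.e
  g := D.g
  hdiam := D.hdiam
  hsec := D.hsec
  hric x w := (D.hric x w).trans' (by
    have := D.inner_self_nonneg x w
    nlinarith)
  f₀ := D.f₀
  hf₀ := D.hf₀
  hconn := D.hconn

/-- `ofLE` does not change the manifold. [cite: HuangHuangWangZhu2026, §4 p. 13] -/
@[simp] theorem ofLE_P (D : CoreDatum κ δ) (h : δ ≤ δ') : (D.ofLE h).P = D.P := rfl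

/-- `ofLE` does not change the circle map. [cite: HuangHuangWangZhu2026, §4 p. 13] -/
@[simp] theorem ofLE_f₀ (D : CoreDatum κ δ) (h : δ ≤ δ') : (D.ofLE h).f₀ = D.f₀ := rfl

/-- `Good` is unchanged by `ofLE` (it does not mention `δ`). [cite: HuangHuangWangZhu2026, §4 p. 14] -/
theorem good_ofLE_iff (D : CoreDatum κ δ) (h : δ ≤ δ') : (D.ofLE h).Good ↔ D.Good :=
  Iff.rfl

end CoreDatum

/-! ### The bundled and the sequential forms of the reduction -/

/-- **(E) in bundled form implies the fact**: if for every `κ > 0` there is `δ > 0` such that every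
datum `D : CoreDatum κ δ` is good, then `huangHuangWangZhu2026_fibresOverCircle_four` holds
(`huangHuangWangZhu2026_fibresOverCircle_four_of_generator_equivariant`, unbundled).
[cite: HuangHuangWangZhu2026, Main Theorem 1 (p. 3), Theorem 1.11 and §4 pp. 13–14] -/
theorem huangHuangWangZhu2026_fibresOverCircle_four_of_coreDatum
    (H : ∀ κ : ℝ, 0 < κ → ∃ δ : ℝ, 0 < δ ∧ ∀ D : CoreDatum κ δ, D.Good) :
    huangHuangWangZhu2026_fibresOverCircle_four := by
  apply huangHuangWangZhu2026_fibresOverCircle_four_of_generator_equivariant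
  intro κ hκ
  obtain ⟨δ, hδ, hD⟩ := H κ hκ
  refine ⟨δ, hδ, ?_⟩
  intro P _ _ _ _ _ _ e g _ hdiam hsec hric f₀ hf₀ hconn
  exact hD
    { P := P, e := e, g := g, hdiam := hdiam, hsec := hsec, hric := hric, f₀ := f₀, hf₀ := hf₀,
      hconn := hconn }

/-- **The contradiction-sequence form** (Huang–Huang–Wang–Zhu 2026, §4 p. 13: "Suppose on the
contrary, there exists a sequence … `εᵢ ↓ 0`, but each `Mᵢ` is not a fiber bundle"): if for every
`κ > 0`, every null sequence `δᵢ > 0` and every sequence of data `Dᵢ : CoreDatum κ δᵢ` some `Dᵢ` is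
good, then `huangHuangWangZhu2026_fibresOverCircle_four` holds. (Were the bundled form false at `κ`,
choose a bad datum for each `δ = 1/(i+1)`.)
[cite: HuangHuangWangZhu2026, §4 p. 13] -/
theorem huangHuangWangZhu2026_fibresOverCircle_four_of_seq
    (H : ∀ κ : ℝ, 0 < κ → ∀ δ : ℕ → ℝ, (∀ i, 0 < δ i) → Tendsto δ atTop (𝓝 0) →
      ∀ D : (i : ℕ) → CoreDatum κ (δ i), ∃ i, (D i).Good) :
    huangHuangWangZhu2026_fibresOverCircle_four := by
  apply huangHuangWangZhu2026_fibresOverCircle_four_of_coreDatum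
  intro κ hκ
  by_contra hne
  have hbad : ∀ i : ℕ, ∃ D : CoreDatum κ (1 / ((i : ℝ) + 1)), ¬ D.Good := by
    intro i
    by_contra hall
    simp only [not_exists, not_not] at hall
    exact hne ⟨1 / ((i : ℝ) + 1), by positivity, hall⟩
  choose D hD using hbad
  obtain ⟨i, hi⟩ := H κ hκ (fun i ↦ 1 / ((i : ℝ) + 1)) (fun i ↦ by positivity)
    tendsto_one_div_add_atTop_nhds_zero_nat D
  exact hD i hi

/-- The same with the sequence normalised by `δᵢ ≤ 1` (the choice `δᵢ = 1/(i+1)` in the proof of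
`huangHuangWangZhu2026_fibresOverCircle_four_of_seq` already satisfies it, so the hypothesis may be
restricted to such sequences; cf. "`εᵢ ↓ 0`", Huang–Huang–Wang–Zhu 2026, §4 p. 13).
[cite: HuangHuangWangZhu2026, §4 p. 13] -/
theorem huangHuangWangZhu2026_fibresOverCircle_four_of_seq_le_one
    (H : ∀ κ : ℝ, 0 < κ → ∀ δ : ℕ → ℝ, (∀ i, 0 < δ i) → (∀ i, δ i ≤ 1) → Tendsto δ atTop (𝓝 0) →
      ∀ D : (i : ℕ) → CoreDatum κ (δ i), ∃ i, (D i).Good) :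
    huangHuangWangZhu2026_fibresOverCircle_four := by
  apply huangHuangWangZhu2026_fibresOverCircle_four_of_coreDatum
  intro κ hκ
  by_contra hne
  have hbad : ∀ i : ℕ, ∃ D : CoreDatum κ (1 / ((i : ℝ) + 1)), ¬ D.Good := by
    intro i
    by_contra hall
    simp only [not_exists, not_not] at hall
    exact hne ⟨1 / ((i : ℝ) + 1), by positivity, hall⟩
  choose D hD using hbad
  have hle : ∀ i : ℕ, 1 / ((i : ℝ) + 1) ≤ 1 := fun i ↦ by
    rw [div_le_one (by positivity)]
    linarith [Nat.cast_nonneg (α := ℝ) i]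
  obtain ⟨i, hi⟩ := H κ hκ (fun i ↦ 1 / ((i : ℝ) + 1)) (fun i ↦ by positivity) hle
    tendsto_one_div_add_atTop_nhds_zero_nat D
  exact hD i hi

end Literature.Geometry.Riemannian
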